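import Literature.Topology.FourManifolds.PontryaginThomCollapse
import HarnessLib

/-!
# `p(M, φ) ≃ 0` is a condition, not a theorem: the framed `0`-sphere in `S⁰`

Topic `Literature/Topology/FourManifolds`. The predicate
`Literature.Topology.FourManifolds.FramedTubularEmbedding.CollapseNullHomotopic E`
(`PontryaginThomCollapse.lean`) says that the Pontryagin–Thom collapse
`p(M, φ) : Sⁿ⁺ᵏ → Sᵏ = ℝᵏ ∪ {∞}` of a framed tubular embedding `E : M × ℝᵏ ↪ Sⁿ⁺ᵏ` is (freely)
null-homotopic. In Kervaire–Milnor, *Groups of homotopy spheres I* (1963), §4, p. 510, this is the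
*hypothesis* of Lemma 4.2 ("The subset `p(M) ⊂ Πₙ` contains the zero element of `Πₙ` if and only
if `M` bounds a parallelizable manifold"), not an assertion about every framed manifold: the
table on p. 512 lists `Πₙ = πₙ₊ₖ(Sᵏ) ≠ 0` for `n = 1, 2, 3, 6, 7, 8`, and unstably the framed
point `* ⊂ Sᵏ` already represents a generator `±ι` of `πₖ(Sᵏ) ≅ ℤ`.

This file records a kernel-checked witness that the universal closure of the predicate is false,
using the one instance of the carrier that needs no homotopy groups: `n = k = 0`, `M = S⁰`,
with the whole of `S⁰ = S⁰ × ℝ⁰` as its trivialised tube. Its collapse `S⁰ → ℝ⁰ ∪ {∞}` is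
constant with the *finite* value `0 ∈ ℝ⁰`, and `ℝ⁰ ∪ {∞}` is a discrete two-point space, so no
homotopy moves it to the constant map `∞`.

## Main statements

* `FramedTubularEmbedding.exists_not_collapseNullHomotopic_zero`: some framed tubular embedding
  `S⁰ × ℝ⁰ ↪ S⁰` has a collapse map which is not null-homotopic.
* `FramedTubularEmbedding.not_forall_collapseNullHomotopic`: hence
  `CollapseNullHomotopic` does not hold for all framed tubular embeddings — it is a genuine
  condition (the one of Kervaire–Milnor's Lemma 4.2), to be *assumed* (as in
  `boundsParallelizable_of_collapseNullHomotopic`) or *derived* from a computation of `Πₙ` (as in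
  `HomotopySphere.exists_collapseNullHomotopic_seven`, `collapseNullHomotopic_of_piStable_four`).

## References

* M. Kervaire, J. Milnor, *Groups of homotopy spheres I*, Ann. of Math. (2) 77 (1963), 504–537:
  §4, p. 510 (`p(M, φ)`, Lemma 4.2) and the table of `Πₙ` on p. 512. doi:10.2307/1970128
  [KervaireMilnorAnnals1963]
-/

open scoped Manifold ContDiff Topology
open Set Function

noncomputable section

namespace Literature.Topology.FourManifolds

/-- Local notation: `𝔼 n` is the model Euclidean space `EuclideanSpace ℝ (Fin n)`. -/
local notation "𝔼 " n:arg => EuclideanSpace ℝ (Fin n)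

/-- Local notation: `𝕊 n` is the unit sphere in `EuclideanSpace ℝ (Fin (n + 1))`. -/
local notation "𝕊 " n:arg => (Metric.sphere (0 : EuclideanSpace ℝ (Fin (n + 1))) 1)

namespace FramedTubularEmbedding

/-- **The framed `0`-sphere in `S⁰` has an essential collapse map.** The projection
`Prod.fst : S⁰ × ℝ⁰ → S⁰` is a framed tubular embedding of `S⁰` in `S⁰` (codimension `k = 0`:
a `C^∞` embedding — in `0`-dimensional charts every map reads `u ↦ (u, 0)` — with open range, the
whole sphere), and its Pontryagin–Thom collapse `S⁰ → ℝ⁰ ∪ {∞}` is not homotopic to the constant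
map `∞`: the collapse takes the finite value `0 ∈ ℝ⁰` at a point `p₀ ∈ S⁰`, the finite part
`ℝ⁰ ⊂ ℝ⁰ ∪ {∞}` is clopen (open as the range of the coercion, closed as the image of the compact
`ℝ⁰`), so along a homotopy `H` the clopen set `{t | H (t, p₀) ∈ ℝ⁰}` of the connected unit
interval contains `0`, hence `1`, where `H (1, p₀) = ∞`. (Kervaire–Milnor state `p(M, φ) ≃ 0` as
the hypothesis of Lemma 4.2, p. 510, not as a theorem.) [folklore] -/
theorem exists_not_collapseNullHomotopic_zero :
    ∃ E : FramedTubularEmbedding 0 0 (𝕊 0), ¬ E.CollapseNullHomotopic := by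
  -- the framed `0`-sphere: tube `S⁰ × ℝ⁰ → S⁰`, `(p, v) ↦ p`
  let E : FramedTubularEmbedding 0 0 (𝕊 0) :=
    { tube := Prod.fst
      isSmoothEmbedding := by
        haveI : Subsingleton (𝔼 (0 + 0)) := inferInstanceAs (Subsingleton (𝔼 0))
        refine ⟨?_, ?_⟩
        · refine Manifold.IsImmersionOfComplement.isImmersion (F := 𝔼 0) fun x => ?_
          exact Manifold.IsImmersionAtOfComplement.mk_of_continuousAt continuousAt_fst
            (LinearEquiv.ofSubsingleton (R := ℝ) (M := (𝔼 0 × 𝔼 0) × 𝔼 0)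
              (M₂ := 𝔼 0)).toContinuousLinearEquiv
            (chartAt (ModelProd (𝔼 0) (𝔼 0)) x) (chartAt (𝔼 0) x.1) (mem_chart_source _ x)
            (mem_chart_source _ x.1) (IsManifold.chart_mem_maximalAtlas x)
            (IsManifold.chart_mem_maximalAtlas x.1)
            fun _ _ => Subsingleton.elim _ _
        · exact (continuous_fst.isClosedEmbedding
            fun a b h => Prod.ext h (Subsingleton.elim _ _)).isEmbedding
      isOpen_range := by
        rw [Prod.range_fst]
        exact isOpen_univ }
  refine ⟨E, ?_⟩
  rintro ⟨H⟩
  -- a point of `S⁰`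
  let p₀ : 𝕊 0 := ⟨EuclideanSpace.single 0 1, by simp⟩
  -- the collapse takes the finite value `0 ∈ ℝ⁰` at `p₀ = tube (p₀, 0)`
  have h0 : E.collapse p₀ = ((0 : 𝔼 0) : OnePoint (𝔼 0)) := E.collapse_tube p₀ 0
  -- the finite part `ℝ⁰ ⊂ ℝ⁰ ∪ {∞}` is clopen
  have hclopen : IsClopen (range ((↑) : 𝔼 0 → OnePoint (𝔼 0))) := by
    refine ⟨?_, OnePoint.isOpen_range_coe⟩
    rw [← image_univ]
    exact OnePoint.isClosed_image_coe.2 ⟨isClosed_univ, isCompact_univ⟩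
  -- its preimage under `t ↦ H (t, p₀)` is clopen in `I` and contains `0`, hence is all of `I`
  have hcont : Continuous fun t : unitInterval => H (t, p₀) :=
    H.continuous.comp (continuous_id.prodMk continuous_const)
  have huniv : (fun t : unitInterval => H (t, p₀)) ⁻¹' range ((↑) : 𝔼 0 → OnePoint (𝔼 0)) =
      univ := by
    refine (hclopen.preimage hcont).eq_univ ⟨0, ?_⟩
    rw [mem_preimage, H.apply_zero, h0]
    exact mem_range_self _
  -- but `H (1, p₀) = ∞` is not finite
  have h1 : (1 : unitInterval) ∈
      (fun t : unitInterval => H (t, p₀)) ⁻¹' range ((↑) : 𝔼 0 → OnePoint (𝔼 0)) :=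
    huniv ▸ mem_univ _
  rw [mem_preimage, H.apply_one, ContinuousMap.const_apply] at h1
  obtain ⟨v, hv⟩ := h1
  exact OnePoint.coe_ne_infty v hv

/-- **`p(M, φ) ≃ 0` is a genuine condition**: it is *not* the case that the Pontryagin–Thom
collapse of every framed tubular embedding is null-homotopic
(`exists_not_collapseNullHomotopic_zero`: the framed `0`-sphere in `S⁰`). Kervaire–Milnor,
p. 510, Lemma 4.2: `0 ∈ p(M)` iff `M` bounds a parallelizable manifold; the table on p. 512 has
`Πₙ ≠ 0` for `n = 1, 2, 3, 6, 7, 8`. [folklore] -/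
theorem not_forall_collapseNullHomotopic :
    ¬ ∀ (n k : ℕ) (M : Type) [TopologicalSpace M] [ChartedSpace (𝔼 n) M] [CompactSpace M]
      (E : FramedTubularEmbedding n k M), E.CollapseNullHomotopic := by
  intro h
  obtain ⟨E, hE⟩ := exists_not_collapseNullHomotopic_zero
  exact hE (h 0 0 _ E)

end FramedTubularEmbedding

end Literature.Topology.FourManifolds
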